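import Summits.BirchSwinnertonDyer.BirchSwinnertonDyer.Theorems.ByReductionTypeAtTwoAdditivePotGoodPrintShuZhai84b1
import Summits.BirchSwinnertonDyer.BirchSwinnertonDyer.Theorems.ByReductionTypeAtTwoAdditivePotGoodPrintShuZhai84a1Witness
import HarnessLib

/-!
# K4 crux `AdditiveRankZeroAtTwo` (19098), children C3″ (22617) / C2″ (22616): the Shu–Zhai road at `84b1` is NOT VACUOUS —
# the member `M = 17*·41* = 697` (`17`, `41` admissible: inert in `ℚ(E[2]) = ℚ(√−3)` and `ℚ(E′[2]) = ℚ(√7)`; `2`, `3`, `7` split in `ℚ(√697)`):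
# `BSD(·, 2)` with both K4 halves at every global minimal `84b1^{(697)}` (rank `0`) and `BSD(·, 2)` at every global minimal `84b1^{(−32759)}`
# (rank `1`), BY NAME from the printed §5.2 Table row

Cell `bsd-2adic`, seat `bsd-2adic-k4-w2` GEN 7 (prover, explicit unit, no kit); `--supports stmt-BirchSwinnertonDyer-22616 --as helper`
(cc C3″ 22617); twin of GEN 6's `…PrintShuZhai84a1Witness.lean` (same admissible primes and the same `M`, since `84a1` and `84b1` have
the same `2`-division fields `ℚ(√−3)` / `ℚ(√7)`, the same bad primes `2, 3, 7` and the same Heegner prime `p = 47`; its arithmetic lemmas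
`prod_qStar_seventeen_fortyone` etc. are reused by import). KERNEL: `Δ(84b1) = −2352 = −3·28²`, `Δ(E′) = 16128 = 7·48²`, inertness of
`17`, `41` from Legendre symbols, coprimality to `2N ∣ 672`, splitting of `2`, `3`, `7` in `ℚ(√697)`. By name: Shu–Zhai Thm. 1.2/1.4,
the Table row `84b1` (`ShuZhai2021.table52_row84b1`), Creutz–Miller, ARS Thm. 2.6, modularity. Closes nothing at the `∀`-level;
nothing booked; BSD is not proved by any of this.

References: [ShuZhai2021] Def. 1.1, Thm. 1.2, Thm. 1.4, §5.2 Table (row 84b1: admissible `5, 11, 17, 23, 41`); [Marcus1977] Ch. 3 Thm. 25.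
-/

set_option autoImplicit false
set_option linter.dupNamespace false

noncomputable section

open scoped Classical

open Module NumberField WeierstrassCurve Literature.NumberTheory.EllipticCurves
  Literature.NumberTheory.EllipticCurves.ModularForms
  Literature.NumberTheory.EllipticCurves.Rank1Residual
  Literature.NumberTheory.EllipticCurves.Rank1Residual.Typed
  Literature.NumberTheory.EllipticCurves.ShuZhai2021
  Literature.NumberTheory.EllipticCurves.AgasheRibetStein2006
  Literature.NumberTheory.QuadraticFields.Quadratic
  Summit.BirchSwinnertonDyer
  Summit.BirchSwinnertonDyer.Rank1Residual
  Summit.BirchSwinnertonDyer.Rank1Residual.X5.O1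
  Summit.BirchSwinnertonDyer.Rank1Residual.P2
  Summit.BirchSwinnertonDyer.BirchSwinnertonDyer.Rank1Residual.IntModel
  Summit.BirchSwinnertonDyer.BirchSwinnertonDyer.Theorems

namespace Summit.BirchSwinnertonDyer.BirchSwinnertonDyer.Theorems.AddPotGoodPrint

/-! ## §9 `ℚ(E[2]) = ℚ(√−3)` and `ℚ(E′[2]) = ℚ(√7)`: `17` and `41` are inert in both -/

/-- **A prime `q` with `(−3/q) = −1` (here `q ∈ {17, 41}`) is inert in `ℚ(√Δ(84b1)) = ℚ(√−2352) = ℚ(√−3)`** (`−2352 = −3·28²`,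
`d_K = −3`). [cite: ShuZhai2021, Def. 1.1] [cite: Marcus1977, Ch. 3 Thm. 25] -/
theorem isInertInSqrt_Δ_84b1 {q : ℕ} [hq : Fact q.Prime] (hleg : legendreSym q (-3) = -1) :
    IsInertInSqrt q (⟨0, -1, 0, -1, -2⟩ : WeierstrassCurve ℚ).Δ := by
  have hΔ : (⟨0, -1, 0, -1, -2⟩ : WeierstrassCurve ℚ).Δ = ((-2352 : ℤ) : ℚ) := by
    norm_num [WeierstrassCurve.Δ, WeierstrassCurve.b₂, WeierstrassCurve.b₄, WeierstrassCurve.b₆, WeierstrassCurve.b₈]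
  rw [hΔ, isInertInSqrt_intCast]
  intro K _ _ h2 hx
  obtain ⟨x, hx⟩ := hx
  have hy : (x / 28) ^ 2 = ((-3 : ℤ) : K) := by
    rw [div_pow, hx]; push_cast; norm_num
  have hd : NumberField.discr K = -3 :=
    discr_eq_of_sq_eq_of_fundamental h2 ⟨by decide, by
        rw [← Int.squarefree_natAbs, show (-3 : ℤ).natAbs = 3 from rfl]; exact Nat.prime_three.prime.squarefree, by norm_num⟩
      (fun r h => by push_cast at h; nlinarith [sq_nonneg r]) hy
  exact BurungaleSkinner2023.isInertIn_of_legendreSym_eq_neg_one h2 (by rw [hd]; exact hleg)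

/-- **A prime `q` with `(28/q) = −1` (here `q ∈ {17, 41}`) is inert in `ℚ(√Δ(E′)) = ℚ(√16128) = ℚ(√7)`** (`16128 = 7·48²`, `d_K = 4·7 = 28`).
[cite: ShuZhai2021, Def. 1.1] [cite: Marcus1977, Ch. 3 Thm. 25] -/
theorem isInertInSqrt_Δ_Ep84b1 {q : ℕ} [hq : Fact q.Prime] (hleg : legendreSym q 28 = -1) :
    IsInertInSqrt q (⟨0, -10, 0, -3, 0⟩ : WeierstrassCurve ℚ).Δ := by
  have hΔ : (⟨0, -10, 0, -3, 0⟩ : WeierstrassCurve ℚ).Δ = ((16128 : ℤ) : ℚ) := by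
    norm_num [WeierstrassCurve.Δ, WeierstrassCurve.b₂, WeierstrassCurve.b₄, WeierstrassCurve.b₆, WeierstrassCurve.b₈]
  rw [hΔ, isInertInSqrt_intCast]
  intro K _ _ h2 hx
  obtain ⟨x, hx⟩ := hx
  have hy : (x / 48) ^ 2 = ((7 : ℤ) : K) := by
    rw [div_pow, hx]; push_cast; norm_num
  have hd : NumberField.discr K = 28 := by
    rw [show (28 : ℤ) = 4 * 7 by norm_num]
    exact discr_eq_four_mul_of_sq_eq_intCast h2 hy (Or.inr (by decide))
      (by rw [show (7 : ℤ) = ((7 : ℕ) : ℤ) by rfl, Int.squarefree_natCast]; exact (by norm_num : Nat.Prime 7).prime.squarefree)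
  exact BurungaleSkinner2023.isInertIn_of_legendreSym_eq_neg_one h2 (by rw [hd]; exact hleg)

/-- **`17` and `41` are admissible for `84b1`** (Def. 1.1: prime, coprime to `2N` — `N ∣ 336` —, inert in `ℚ(√−3)` and `ℚ(√7)`;
Shu–Zhai's table lists both). [cite: ShuZhai2021, Def. 1.1 and §5.2 Table (row 84b1)] -/
theorem isAdmissible_seventeen_fortyone_84b1 :
    haveI := isElliptic_84b1
    IsAdmissible (⟨0, -1, 0, -1, -2⟩ : WeierstrassCurve ℚ) (⟨0, -10, 0, -3, 0⟩ : WeierstrassCurve ℚ) 17 ∧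
      IsAdmissible (⟨0, -1, 0, -1, -2⟩ : WeierstrassCurve ℚ) (⟨0, -10, 0, -3, 0⟩ : WeierstrassCurve ℚ) 41 := by
  have n17a : ¬ IsSquare ((-3 : ℤ) : ZMod 17) := by decide
  have n17b : ¬ IsSquare ((28 : ℤ) : ZMod 17) := by decide
  have n41a : ¬ IsSquare ((-3 : ℤ) : ZMod 41) := by decide
  have n41b : ¬ IsSquare ((28 : ℤ) : ZMod 41) := by decide
  haveI := isElliptic_84b1
  haveI : Fact (Nat.Prime 17) := ⟨by norm_num⟩
  haveI : Fact (Nat.Prime 41) := ⟨by norm_num⟩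
  have h2N : 2 * (⟨0, -1, 0, -1, -2⟩ : WeierstrassCurve ℚ).conductorNorm ℤ ∣ 672 := mul_dvd_mul_left 2 conductorNorm_dvd_336_84b1
  have l17a : legendreSym 17 (-3) = -1 := (legendreSym.eq_neg_one_iff 17).mpr n17a
  have l17b : legendreSym 17 28 = -1 := (legendreSym.eq_neg_one_iff 17).mpr n17b
  have l41a : legendreSym 41 (-3) = -1 := (legendreSym.eq_neg_one_iff 41).mpr n41a
  have l41b : legendreSym 41 28 = -1 := (legendreSym.eq_neg_one_iff 41).mpr n41b
  exact ⟨⟨by norm_num, Nat.Coprime.coprime_dvd_right h2N (by norm_num), isInertInSqrt_Δ_84b1 l17a, isInertInSqrt_Δ_Ep84b1 l17b⟩,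
    ⟨by norm_num, Nat.Coprime.coprime_dvd_right h2N (by norm_num), isInertInSqrt_Δ_84b1 l41a, isInertInSqrt_Δ_Ep84b1 l41b⟩⟩

/-! ## §10 `M = 17*·41* = 697`: every `ℓ ∣ 2N` splits in `ℚ(√697)` -/

/-- **In every quadratic field containing `√697`, the primes `2`, `3` and `7` split** (`d = 697 = 17·41 ≡ 1 (mod 8)`, `(697/3) = (1/3) = 1`,
`(697/7) = (4/7) = 1`): Thm. 1.4 (ii) «every `ℓ ∣ 2N` splits in `ℚ(√M)`» for `M = 697`. [cite: ShuZhai2021, Thm. 1.4 (ii)] [cite: Marcus1977, Ch. 3 Thm. 25] -/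
theorem allPrimesSplitInSqrt_697_84b1 :
    haveI := isElliptic_84b1
    AllPrimesSplitInSqrt (2 * (⟨0, -1, 0, -1, -2⟩ : WeierstrassCurve ℚ).conductorNorm ℤ) 697 := by
  haveI := isElliptic_84b1
  refine Or.inr fun F _ _ h2 hx => ?_
  obtain ⟨x, hx⟩ := hx
  have hsq : Squarefree (697 : ℤ) := by
    rw [show (697 : ℤ) = (697 : ℕ) by rfl, Int.squarefree_natCast]; exact (by decide +kernel : Squarefree (697 : ℕ))
  have hd : NumberField.discr F = 697 :=
    discr_eq_of_sq_eq_of_fundamental h2 ⟨by decide, hsq, by norm_num⟩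
      (fun r h => by
        have h' : ∃ s : ℚ, s * s = 697 := ⟨r, by push_cast at h; rw [← sq]; exact h⟩
        rw [Rat.exists_mul_self] at h'
        exact absurd h' (by norm_num [Rat.sqrt, Nat.sqrt])) (by exact_mod_cast hx)
  have h2s : ((Ideal.span {(2 : ℤ)}).primesOver (𝓞 F)).ncard = 2 := (ncard_primesOver_two_eq_two_iff h2).mpr (by rw [hd]; decide)
  have h697a : ((697 : ℤ) : ZMod 3) ≠ 0 := by decide
  have hsqa : IsSquare ((697 : ℤ) : ZMod 3) := ⟨1, by decide⟩
  have h697b : ((697 : ℤ) : ZMod 7) ≠ 0 := by decide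
  have hsqb : IsSquare ((697 : ℤ) : ZMod 7) := ⟨2, by decide⟩
  haveI : Fact (Nat.Prime 3) := ⟨by norm_num⟩
  haveI : Fact (Nat.Prime 7) := ⟨by norm_num⟩
  have h3s : ((Ideal.span {(3 : ℤ)}).primesOver (𝓞 F)).ncard = 2 :=
    (ncard_primesOver_eq_two_iff_legendreSym h2 (by norm_num)).mpr (by rw [hd]; exact (legendreSym.eq_one_iff 3 h697a).mpr hsqa)
  have h7s : ((Ideal.span {(7 : ℤ)}).primesOver (𝓞 F)).ncard = 2 :=
    (ncard_primesOver_eq_two_iff_legendreSym h2 (by norm_num)).mpr (by rw [hd]; exact (legendreSym.eq_one_iff 7 h697b).mpr hsqb)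
  intro p hp hpN
  rcases eq_two_or_three_or_seven_of_dvd_two_mul_conductorNorm_84b1 hp hpN with rfl | rfl | rfl
  · simpa using h2s
  · simpa using h3s
  · simpa using h7s

/-! ## §11 The members `84b1^{(697)}` (rank `0`) and `84b1^{(−32759)}` (rank `1`) -/

/-- **BSD₂ (both K4 halves, `r_an = 0`, habitat) at every global minimal model of `84b1^{(697)}`** — `Q = {17, 41}` admissible IN THE
KERNEL, `2`, `3`, `7` split in `ℚ(√697)` IN THE KERNEL; no displayed base datum; by name: Shu–Zhai Thm.
1.2/1.4, the Table row `84b1`, Creutz–Miller, ARS Thm. 2.6, modularity. BSD is not proved by any of this.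
[cite: ShuZhai2021, Thm. 1.2 and Thm. 1.4] [cite: CreutzMiller2012, Thm. 1.1] [cite: Miller2011LMS, Def. 1.1] -/
theorem printFamily84b1_witness697 (h12 : thm12_ranks_of_twists) (h14 : thm14_twoPartBSD_of_twists)
    (h26 : cremona_abs_maninConstant_eq_one_of_level_le) (hCM : bsdTriple_of_analyticRank_le_one_of_conductor_lt)
    (hmod : hasEntireLFunction_rat)
    (htab : table52_row84b1)
    (W : WeierstrassCurve ℚ) [W.IsElliptic] [W.IsGloballyMinimal]
    (hW : ∃ C : VariableChange ℚ, C • (⟨0, -1, 0, -1, -2⟩ : WeierstrassCurve ℚ).quadraticTwist 697 = W) :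
    haveI : Fact (Nat.Prime 2) := ⟨Nat.prime_two⟩
    W.analyticRank = 0 ∧ Addv W 2 ∧ 0 ≤ padicValRat 2 W.j ∧ ¬ W.HasCM ∧ Red W 2 ∧
      BSDp W 2 ∧ MissingLowerBoundAt W 2 ∧ MissingUpperBoundAt W 2 := by
  haveI := isElliptic_84b1
  have hQ : ∀ q ∈ ({17, 41} : Finset ℕ),
      IsAdmissible (⟨0, -1, 0, -1, -2⟩ : WeierstrassCurve ℚ) (⟨0, -10, 0, -3, 0⟩ : WeierstrassCurve ℚ) q ∧ q ≠ 47 := by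
    intro q hq
    simp only [Finset.mem_insert, Finset.mem_singleton] at hq
    rcases hq with rfl | rfl
    · exact ⟨isAdmissible_seventeen_fortyone_84b1.1, by norm_num⟩
    · exact ⟨isAdmissible_seventeen_fortyone_84b1.2, by norm_num⟩
  have hQM := allPrimesSplitInSqrt_697_84b1
  rw [← prod_qStar_seventeen_fortyone] at hQM
  have hW' : ∃ C : VariableChange ℚ, C • (⟨0, -1, 0, -1, -2⟩ : WeierstrassCurve ℚ).quadraticTwist
      ((∏ q ∈ ({17, 41} : Finset ℕ), qStar q : ℤ) : ℚ) = W := by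
    rw [prod_qStar_seventeen_fortyone]; exact_mod_cast hW
  exact printFamily84b1_of_shuZhai_of_table52 h12 h14 htab h26 hCM hmod {17, 41} hQ hQM W hW'

/-- **`r_an = 1 ∧ BSD₂` (with the habitat) at every global minimal model of `84b1^{(−32759)}`**, `−32759 = −47·17*·41*` — the rank-ONE
companion member. BSD is not proved by any of this. [cite: ShuZhai2021, Thm. 1.2 and Thm. 1.4] [cite: CreutzMiller2012, Thm. 1.1] -/
theorem printFamily84b1_rankOne_witness32759 (h12 : thm12_ranks_of_twists) (h14 : thm14_twoPartBSD_of_twists)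
    (h26 : cremona_abs_maninConstant_eq_one_of_level_le) (hCM : bsdTriple_of_analyticRank_le_one_of_conductor_lt)
    (hmod : hasEntireLFunction_rat)
    (htab : table52_row84b1)
    (W₁ : WeierstrassCurve ℚ) [W₁.IsElliptic] [W₁.IsGloballyMinimal]
    (hW₁ : ∃ C : VariableChange ℚ, C • (⟨0, -1, 0, -1, -2⟩ : WeierstrassCurve ℚ).quadraticTwist (-32759) = W₁) :
    haveI : Fact (Nat.Prime 2) := ⟨Nat.prime_two⟩
    W₁.analyticRank = 1 ∧ Addv W₁ 2 ∧ 0 ≤ padicValRat 2 W₁.j ∧ ¬ W₁.HasCM ∧ Red W₁ 2 ∧ BSDp W₁ 2 := by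
  haveI := isElliptic_84b1
  have hQ : ∀ q ∈ ({17, 41} : Finset ℕ),
      IsAdmissible (⟨0, -1, 0, -1, -2⟩ : WeierstrassCurve ℚ) (⟨0, -10, 0, -3, 0⟩ : WeierstrassCurve ℚ) q ∧ q ≠ 47 := by
    intro q hq
    simp only [Finset.mem_insert, Finset.mem_singleton] at hq
    rcases hq with rfl | rfl
    · exact ⟨isAdmissible_seventeen_fortyone_84b1.1, by norm_num⟩
    · exact ⟨isAdmissible_seventeen_fortyone_84b1.2, by norm_num⟩
  have hQM := allPrimesSplitInSqrt_697_84b1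
  rw [← prod_qStar_seventeen_fortyone] at hQM
  have hW' : ∃ C : VariableChange ℚ, C • (⟨0, -1, 0, -1, -2⟩ : WeierstrassCurve ℚ).quadraticTwist
      ((-(47 : ℕ) * ∏ q ∈ ({17, 41} : Finset ℕ), qStar q : ℤ) : ℚ) = W₁ := by
    rw [prod_qStar_seventeen_fortyone]; norm_num; exact hW₁
  exact printFamily84b1_rankOne_of_shuZhai_of_table52 h12 h14 htab h26 hCM hmod {17, 41} hQ hQM W₁ hW'

end Summit.BirchSwinnertonDyer.BirchSwinnertonDyer.Theorems.AddPotGoodPrint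

end
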